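import Summits.BirchSwinnertonDyer.Rank1Residual.X9.HessePartnerTransportRankZero
import Summits.BirchSwinnertonDyer.Rank1Residual.X9.ChaDescentRecords
import Literature.NumberTheory.EllipticCurves.Rank1Residual.X9ChaCertificate
import HarnessLib

/-!
# Class X9, `p = 5`: TRANSPORT FROM BEYOND THE TABLES, part F — `BSD(E,5)` for flagged-only X9 pairs from `5`-congruent partners
# found in Fisher's Hesse pencils `X_E(5)` / `X_E⁻(5)` OUTSIDE Cremona's range, with the partners' own Heegner-index records (kernel)

HONEST FRAMING (cell `b2b-bsdres-*`, verbatim): the cell deletes COMBINATION-SHAPED residual classes of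
the rank-≤1 BSD formula from PUBLISHED theorems only and TYPES the construction-shaped remainder; this
is not "finishing BSD". Class X9 (good ordinary `p ≥ 5`, `ρ̄_{E,p}` irreducible and not surjective) stays
TYPED at class level; everything here is PER PAIR; no lane verdict is changed; no named fact is introduced;
nothing is booked by this unit (the lane books, the referee rules). Unit `b2b-bsdres-x9`, gen 17
(generic consumers and the full account: `X9/HessePartnerTransport.lean`; census `HOME/b2b-bsdres-x9/X9-CENSUS-G17.md`).

## What this file does (our own work, hence `Summits/`)

After gen 16, 40 X9 pairs `(E,5)` (`N < 5·10⁵`, `r_an ≤ 1`, all `5S4`) had no flag-free route of record (only the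
Jetchev–Cha index bound: one multiplicative prime `ℓ` with `5 ∣ c_ℓ`) and NO usable congruent partner inside Cremona's
table. Gen 17 searched the two explicit families of ALL `5`-congruent curves (Fisher 2012 Thm. 13.2 = Rubin–Silverberg;
Fisher 2013 Thm. 5.8) for partners `F` beyond the table with `5 ∤ N_F`, good ordinary at `5`, every Tamagawa number
prime to `5`, analytic rank `≤ 1` — kit j134197–j134206 / j134278–j134287 (46 800 + 120 000 members analysed) — and
CERTIFIED for the partners below: the Heegner index of `5`-adic order `0` (ENGINE 1 = the gen-7 engine-1b formula
`m = √(4·hy/ĥ(g))`, Miller 2011 Thm. 4.1 / Cor. 4.8 normalisation, for rank-`1` partners with the generator from PARI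
`ellheegner` saturated at all primes `≤ 100` and tested NOT `5`-divisible (`ellisdivisible`), kit j134313; ENGINE 1c
`heegK` = gen-11 byte copy for rank-`0` partners, kit j134348–j134355), the analytic rank (root number exact, `L`/`L′`
numerically non-zero), `#Ш_an` (a `5`-adic unit), C3 (PARI `ellpadicheight` valuations finite) and — for the congruence
C1 — the EXACT identity "`F` is the minimal model of the pencil member `E_{l,m}`" (an explicit change of variables `C`,
decided in the kernel by `norm_num` from the two evaluated Hesse covariants `𝔠₄(l,m) = r₄`, `𝔠₆(l,m) = r₆`, displayed
binders `h4`/`h6`: exact rationals from ENGINE P `hesse_exact.py` (pure Python, syzygy-checked) = PARI `subst` in the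
search job). Per pair: §2 the PARTNER's record `bsdp_<tag> : BSDp F 5` (Cha 2005 / Miller Thm. 5.2 with the index
certificate `5 ∤ [F(K) : ℤy_K]` and `5 ∤ #Ш_an(F)`; `F` non-CM, `F[5]` irreducible, `Δ ≠ 0`, minimality all decided in
the kernel from the integer model), §3 the TRANSPORT record `bsdp_t<E>_of_bsdp_<tag>` (gen 17 consumer
`bsdp_of_ainvs_of_bsdpPartner_of_hessePencil5{ind}_of_analyticRank_le_one`: BCS 2025 Thm. 1.1.2 (a) + `BSD(F,5)` + C2 +
C3 ⟹ Mazur's main conjecture for `(F,5)` with `μ = 0` ⟹ Greenberg–Vatsal (1.4) ⟹ `BSD(E,5)`) and the composition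
`bsdp_t<E>_via_<tag>` whose only non-published binders are finite certificates. C2 of a RANK-1 partner (`hcertA`, a
unit coefficient of `ϖ·L_5(f_F, α)`) is displayed: this unit certifies it, where it can, through Perrin-Riou's
leading-term formula (tree fact `perrinRiou_rankOne_leadingTerms`: `[T¹](ϖL_5)·log_5 γ = (1−α⁻¹)²·(L′(F,1)/(Ω_F ĥ(g)))·h_5(g)`),
i.e. `v₅ = 0` iff non-anomalous, `v₅(L′(F,1)/(Ω_F ĥ(g))) = 0` and `v₅(h_5(g)) = 1` — recorded per theorem ("C2′");
where that valuation is not `0` (or `F` is anomalous) the binder is NOT certified by this unit and the record is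
CONDITIONAL on it (said in its docstring).

References: T. Fisher, Proc. LMS 104 (2012) Thm. 13.2 [Fisher2012Hessian]; Math. Ann. 356 (2013) Thm. 5.8
[Fisher2013QuinticTwists]; R. Greenberg, V. Vatsal, Invent. Math. 142 (2000) Thm. (1.4) [GreenbergVatsal2000];
A. Burungale, F. Castella, C. Skinner, IMRN 2025 Thm. 1.1.2 (a) [BurungaleCastellaSkinner2025]; B. Cha, J. Number Theory 111
(2005) [Cha2005]; R. L. Miller, LMS J. Comput. Math. 14 (2011) Thm. 4.1, Cor. 4.8, Thm. 5.2, Def. 1.1 [Miller2011LMS];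
B. Perrin-Riou, Invent. Math. 89 (1987) §1.4 [PerrinRiou1987]; R. Greenberg, LNM 1716 Thm. 4.1 [GreenbergLNM1716];
B. Mazur, IHÉS 47 (1978) Prop. 6.3 (1) [Mazur1978]; J. H. Silverman, AEC III §1, VII.1, App. C §11 [SilvermanAEC2009].
-/

set_option autoImplicit false

noncomputable section

open scoped Classical MatrixGroups ModularForm

open CongruenceSubgroup WeierstrassCurve Literature.NumberTheory.EllipticCurves
  Literature.NumberTheory.EllipticCurves.ModularForms Literature.NumberTheory.EllipticCurves.Rank1Residual
  Literature.NumberTheory.EllipticCurves.Rank1Residual.Typed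
  Literature.NumberTheory.EllipticCurves.Rank1Residual.X11RankOneCertificates
  Literature.NumberTheory.EllipticCurves.Fisher2012
  Summit.BirchSwinnertonDyer.BirchSwinnertonDyer.Rank1Residual.IntModel
  Summit.BirchSwinnertonDyer.BirchSwinnertonDyer.Rank1Residual.X11RankOne
  Summit.BirchSwinnertonDyer.Rank1Residual.X11b

namespace Summit.BirchSwinnertonDyer.Rank1Residual.X9


/-! ### §1. Kernel-decided data of the literal models -/

/-- `#{Ẽ(𝔽_5)} = 8` for the integer model `t155682d1` (`a₅ = -2`: good ORDINARY; kernel count). [folklore] -/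
theorem card_t155682d1_5 :
    Nat.card (((⟨1, -1, 1, -41, -55⟩ : WeierstrassCurve ℤ).map
      (Int.castRingHom (ZMod 5))).toAffine.Point) = 8 := by
  rw [@WeierstrassCurve.natCard_point_eq_one_add_card (ZMod 5) (@ZMod.instField 5 ⟨by norm_num⟩) _ _ _
    (by decide +kernel), @card_sol_eq_sum_euler (ZMod 5) (@ZMod.instField 5 ⟨by norm_num⟩) _ _
    (by rw [ZMod.ringChar_zmod_n]; decide), ZMod.card]
  decide +kernel

/-- `#{Ẽ(𝔽_7)} = 3` for the integer model `t155682d1` (`a_7 = 5`; `X² − a_7X + 7` root-free mod `5`; kernel count). [folklore] -/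
theorem card_t155682d1_7 :
    Nat.card (((⟨1, -1, 1, -41, -55⟩ : WeierstrassCurve ℤ).map
      (Int.castRingHom (ZMod 7))).toAffine.Point) = 3 := by
  rw [@WeierstrassCurve.natCard_point_eq_one_add_card (ZMod 7) (@ZMod.instField 7 ⟨by norm_num⟩) _ _ _
    (by decide +kernel), @card_sol_eq_sum_euler (ZMod 7) (@ZMod.instField 7 ⟨by norm_num⟩) _ _
    (by rw [ZMod.ringChar_zmod_n]; decide), ZMod.card]
  decide +kernel

/-- The integer model `t155682d1` is an elliptic curve (`Δ ≠ 0`, kernel). [cite: Cremona2006, Table 1 (Cremona label 155682d1)] -/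
theorem isElliptic_t155682d1 : (⟨1, -1, 1, -41, -55⟩ : WeierstrassCurve ℚ).IsElliptic :=
  isElliptic_of_discOf_ne_zero 1 (-1) 1 (-41) (-55) (by decide +kernel)

/-- The integer model `t155682d1` is globally minimal (Kraus' bounded criterion, kernel). [cite: SilvermanAEC2009, VII.1 Remark 1.1] -/
theorem isGloballyMinimal_t155682d1 : (⟨1, -1, 1, -41, -55⟩ : WeierstrassCurve ℚ).IsGloballyMinimal :=
  isGloballyMinimal_of_krausCriterion_bounded₂ 1 (-1) 1 (-41) (-55) (by decide +kernel) (by decide +kernel)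
    (by decide +kernel)

/-- `#{Ẽ(𝔽_5)} = 3` for the integer model `h155682d1_f2_m15_1` (`a₅ = 3`: good ORDINARY; kernel count). [folklore] -/
theorem card_h155682d1_f2_m15_1_5 :
    Nat.card (((⟨0, 0, 1, 32829, 2026834⟩ : WeierstrassCurve ℤ).map
      (Int.castRingHom (ZMod 5))).toAffine.Point) = 3 := by
  rw [@WeierstrassCurve.natCard_point_eq_one_add_card (ZMod 5) (@ZMod.instField 5 ⟨by norm_num⟩) _ _ _
    (by decide +kernel), @card_sol_eq_sum_euler (ZMod 5) (@ZMod.instField 5 ⟨by norm_num⟩) _ _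
    (by rw [ZMod.ringChar_zmod_n]; decide), ZMod.card]
  decide +kernel

/-- `#{Ẽ(𝔽_7)} = 8` for the integer model `h155682d1_f2_m15_1` (`a_7 = 0`; `X² − a_7X + 7` root-free mod `5`; kernel count). [folklore] -/
theorem card_h155682d1_f2_m15_1_7 :
    Nat.card (((⟨0, 0, 1, 32829, 2026834⟩ : WeierstrassCurve ℤ).map
      (Int.castRingHom (ZMod 7))).toAffine.Point) = 8 := by
  rw [@WeierstrassCurve.natCard_point_eq_one_add_card (ZMod 7) (@ZMod.instField 7 ⟨by norm_num⟩) _ _ _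
    (by decide +kernel), @card_sol_eq_sum_euler (ZMod 7) (@ZMod.instField 7 ⟨by norm_num⟩) _ _
    (by rw [ZMod.ringChar_zmod_n]; decide), ZMod.card]
  decide +kernel

/-- The integer model `h155682d1_f2_m15_1` is an elliptic curve (`Δ ≠ 0`, kernel). [cite: Fisher2012Hessian, Thm. 13.2 (a member of the Hesse pencil, minimal model)] -/
theorem isElliptic_h155682d1_f2_m15_1 : (⟨0, 0, 1, 32829, 2026834⟩ : WeierstrassCurve ℚ).IsElliptic :=
  isElliptic_of_discOf_ne_zero 0 0 1 32829 2026834 (by decide +kernel)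

/-- The integer model `h155682d1_f2_m15_1` is globally minimal (Kraus' bounded criterion, kernel). [cite: SilvermanAEC2009, VII.1 Remark 1.1] -/
theorem isGloballyMinimal_h155682d1_f2_m15_1 : (⟨0, 0, 1, 32829, 2026834⟩ : WeierstrassCurve ℚ).IsGloballyMinimal :=
  isGloballyMinimal_of_krausCriterion_bounded₂ 0 0 1 32829 2026834 (by decide +kernel) (by decide +kernel)
    (by decide +kernel)


/-! ### §2. The partners' own `5`-parts (Cha 2005 with the Heegner-index certificate) -/

/-- **The PARTNER's `5`-part: `BSD(F,5)` for `F = [0, 0, 1, 32829, 2026834]`** (tag `h155682d1_f2_m15_1`: the member `(l : m) = (-15 : 1)` of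
the indirect family `X_E⁻(5)` of `E = 155682d1`, reduced to its minimal model; `N_F = 10819899` = `3 · 31 · 139`-supported,
OUTSIDE Cremona's table; good ORDINARY at `5` with `a₅(F) = 3`; Tamagawa product `1` and torsion `1` (both prime to `5`); root number `1`;
rank-`0` partner: `L(F,1) = 1.16177`, `#Ш_an(F) = 4`; Heegner index row (ENGINE 1b `jobD1b.py`, gen-7 byte copy, Miller's normalisation `m = √(4·ĥ(y_K)_{GZ}/ĥ(x))`, kit j135948): `D = -23`, `m = 4` (the generator `x` of the rank-1 twist `F^{(−23)}` (`N = 5723726571`, minimal model `[0, 0, 1, 17366541, −24660492320]`) found by `ellrank` (effort 0), saturated at all primes `≤ 100`, `ĥ(x) = 31.634…`, `ρ = ĥ(y_K)_{GZ}/ĥ(x) = 4.000…`, `x = [15519241692176/11482194025, 44037087101498448549/1230374500748875]`; ENGINE 2 (gen-7 `run_cert.py` BYTE COPY, synthetic anchor lines = ENGINE 1 values, disclosed) AGREES: `m = 4`, `v₅(m) = 0` identical, `dL ≤ 2.2·10⁻¹⁴`, `dĥ = 0`, every side check true (the heegK division engine, kit j134997, was still running on the same row at filing)); C3 PARI `ellpadicheight`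 valuations n/a) — from Cha 2005 / Miller 2011 Thm. 5.2 (`hCha`) and GZK (`hGZK`) with the
finite certificates as displayed binders: `r_an(F) ≤ 1`, the Heegner field `K` and point `P = y_K` with `5 ∤ [F(K) : ℤ P]` (`hI`), `#Ш_an(F) = q`
with `ord₅ q = 0`; DECIDED IN THE KERNEL from the integer model: `Δ ≠ 0`, global minimality (Kraus), `F` non-CM (`j ∉` the 13 CM values),
`F[5]` irreducible (Frobenius witness `ℓ = 7`: `#F̃(𝔽_7) = 8`, `a_7 = 0`, `X² − a_7X + 7` root-free mod `5`). Per pair; nothing booked here.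
[cite: Miller2011LMS, Thm. 5.2 and Def. 1.1] [cite: Mazur1978, §6 Prop. 6.3 (1) (p. 153)] [cite: SilvermanAEC2009, App. C §11] -/
theorem bsdp_h155682d1_f2_m15_1 (hCha : Cha2005.thm52_padicValNat_shaOrder_le)
    (hGZK : rank_eq_analyticRank_of_analyticRank_le_one)
    (A : WeierstrassCurve ℚ) (hA : A = ⟨0, 0, 1, 32829, 2026834⟩) (hrA : A.analyticRank ≤ 1)
    {N : ℕ} [NeZero N] {K : Type} [Field K] [NumberField K] (hK : IsImaginaryQuadratic K)
    (hH : SatisfiesHeegnerHypothesis N K) {P : (A.baseChange K).toAffine.Point}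
    (hP : IsHeegnerPoint N A K P) (hnt : ¬ IsOfFinAddOrder P)
    (hpD : ¬ (5 : ℤ) ∣ NumberField.discr K) (hpN : ¬ 5 ^ 2 ∣ N)
    (hI : ¬ 5 ∣ (AddSubgroup.zmultiples P).index)
    {q : ℚ} (hq : shaAn A = (q : ℂ)) (hv : padicValRat 5 q = 0) : BSDp A 5 := by
  subst hA
  haveI := isElliptic_h155682d1_f2_m15_1
  haveI := isGloballyMinimal_h155682d1_f2_m15_1
  haveI : Fact (Nat.Prime 5) := ⟨by norm_num⟩
  haveI : Fact (Nat.Prime 7) := ⟨by norm_num⟩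
  have hIA : integralModelInt (⟨0, 0, 1, 32829, 2026834⟩ : WeierstrassCurve ℚ) = ⟨0, 0, 1, 32829, 2026834⟩ :=
    integralModelInt_eq_of_map_eq _ (map_mk_int _ _ _ _ _)
  have hΔ : (⟨0, 0, 1, 32829, 2026834⟩ : WeierstrassCurve ℤ).Δ = discOf [0, 0, 1, 32829, 2026834] := intCurve_Δ 0 0 1 32829 2026834
  have hj : ((c4Of [0, 0, 1, 32829, 2026834] ^ 3 : ℤ) : ℚ) / ((discOf [0, 0, 1, 32829, 2026834] : ℤ) : ℚ) ∉ cmJInvariants := by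
    decide +kernel
  have hcm : ¬ (⟨0, 0, 1, 32829, 2026834⟩ : WeierstrassCurve ℚ).HasCM := fun hCM ↦
    hj (j_eq_of_intModel 0 0 1 32829 2026834 hIA ▸ (hasCM_iff_j_mem_holds _).mp hCM)
  have hirr : (⟨0, 0, 1, 32829, 2026834⟩ : WeierstrassCurve ℚ).HasIrreducibleModPGaloisRep 5 := by
    refine hasIrreducibleModPGaloisRep_of_intModel_of_noroot hIA 5 7 (by norm_num)
      (by rw [hΔ]; decide +kernel) card_h155682d1_f2_m15_1_7 (forall_zmod_of_forall_lt fun t ht h0 ↦ ?_)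
    have hnoroot : ∀ t : ℕ, t < 5 → ¬ (5 : ℤ) ∣ (t : ℤ) ^ 2 - ((7 : ℤ) + 1 - (8 : ℕ)) * t + 7 := by decide
    refine hnoroot t ht ?_
    have h5 : ((5 : ℕ) : ℤ) ∣ (t : ℤ) ^ 2 - ((7 : ℤ) + 1 - (8 : ℕ)) * t + 7 := by
      rw [← ZMod.intCast_zmod_eq_zero_iff_dvd]
      push_cast at h0 ⊢
      linear_combination h0
    exact_mod_cast h5
  exact Typed.bsdp_of_cha_of_not_dvd_index _ 5 hCha hGZK hK hH hP hnt hcm (by norm_num) hpD hpN hirr hI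
    hrA hq hv


/-! ### §3. The transports -/

/-- **`BSD(E,5)` for `155682d1`** (Cremona model `[1, -1, 1, -41, -55]`, `N = 155682`, analytic rank `1`, `#Ш_an = 1.00000000000000`, Tamagawa product
`5` with `ord₅ ≥ 1` — the Jetchev–Cha-flagged X9 pair (`5S4`, good ORDINARY at `5` with `a₅ = -2`);
lane: literal, flag `JET@nonsurj@5`) **by Greenberg–Vatsal transport from the partner `F = [0, 0, 1, 32829, 2026834]` OUTSIDE the tables** (tag `h155682d1_f2_m15_1`,
`N_F = 10819899`): `F` is the minimal model of the member `(l : m) = (-15 : 1)` of Fisher's indirect family `X_E⁻(5)` (Math. Ann. 2013 Thm. 5.8, `hF'`)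
— C1 is the THEOREM `F[5] ≅ E[5]`, the only data being the exact evaluations `𝔠₄(-15,1) = r₄`, `𝔠₆(-15,1) = r₆`
(binders `h4`, `h6`: ENGINE P exact + PARI) and the change of variables `(u, r, s, t) = (1/81896033746944, 0, 0, -1/2)` with `C • F = E_{l,m}`
(decided here by `norm_num`). Partner binders: `r_an(F) ≤ 1`, `BSDp F 5` (= `bsdp_h155682d1_f2_m15_1` with its Heegner certificate), C3 `hSchA`
(vacuous: `r_an(F) = 0`), C2 `hcertA` (DISCHARGED IN THE KERNEL by `unitCoeff_zero_of_lvalue`: `F` non-anomalous (`a₅ = 3`), `L(F,1)/Ω_F = #Ш_an·∏c/#tors² = 4·1/1 = 4` (`hL`, two engines) a `5`-unit). Target binders: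
`r_an(E) = 1` (Cremona), C3 `hC3` (Schneider: the lineage's two-engine certificate for rank-1 targets); C2 of `E` itself is not an input of this direction. Galois/reduction data of BOTH curves
decided in the kernel (`5 ∤ Δ`, `#Ẽ(𝔽₅) = 8`, `#F̃(𝔽₅) = 3`, Frobenius witness `ℓ = 7` for `E[5]`). Per pair; X9 stays typed; nothing booked here.
[cite: Fisher2013QuinticTwists, Thm. 5.8] [cite: GreenbergVatsal2000, Thm. (1.4) (arXiv p. 5)]
[cite: BurungaleCastellaSkinner2025, Thm. 1.1.2 (a) (p. 2 of arXiv:2405.00270v2)] [cite: Mazur1978, §6 Prop. 6.3 (1) (p. 153)] -/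
theorem bsdp_t155682d1_of_bsdp_h155682d1_f2_m15_1
    (hF' : thm58_fiveCongruent_hessePencilInd)
    (hBCS : burungale_castella_skinner_charIdeal_eq_padicLFunction)
    (hGr : greenberg_charValue_rankZero) (h5 : realPeriodRat_eq_unit_mul_plusPeriod)
    (hGV : GreenbergVatsal2000.thm14_mainConjecture_transfer_of_torsionIso)
    (hS : Schneider1985_order_charGenerator) (hPR : perrinRiou_rankOne_leadingTerms)
    (hmodP : nonempty_modularParametrizationData) (hmodL : hasEntireLFunction_rat)
    (hGZK : rank_eq_analyticRank_of_analyticRank_le_one)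
    (W A : WeierstrassCurve ℚ) [W.IsElliptic] [W.IsGloballyMinimal] [A.IsElliptic] [A.IsGloballyMinimal]
    [Fact (Nat.Prime 5)]
    (hW : W = ⟨1, -1, 1, -41, -55⟩) (hA : A = ⟨0, 0, 1, 32829, 2026834⟩)
    (hrE : W.analyticRank = 1) (hrA0 : A.analyticRank = 0) (hbsdA : BSDp A 5)
    (hSchA : A.analyticRank = 1 → ∀ Dh : PAdicHeightData A 5, Dh.IsCanonical → SchneiderConjecture Dh)
    (hLA : A.entireLFunction 1 / (A.realPeriodRat : ℂ) = (((4 : ℕ) : ℚ) : ℂ))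
    (h4 : MvPolynomial.eval ![(-15 : ℚ), 1] (hesseC4ind (1953 : ℚ) (56079)) = (-123063109616859968279457627385560852485700016511314330386432 : ℚ))
    (h6 : MvPolynomial.eval ![(-15 : ℚ), 1] (hesseC6ind (1953 : ℚ) (56079)) = (-38218660992118817421111733816710067292450696958054445143338714070035159966622273081704448 : ℚ))
    (hC3 : W.analyticRank = 1 → ∀ Dh : PAdicHeightData W 5, Dh.IsCanonical → SchneiderConjecture Dh) :
    BSDp W 5 := by
  have hIW : integralModelInt W = ⟨1, -1, 1, -41, -55⟩ :=
    integralModelInt_eq_of_map_eq _ (by rw [hW]; ext <;> simp [WeierstrassCurve.map])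
  have hIA : integralModelInt A = ⟨0, 0, 1, 32829, 2026834⟩ :=
    integralModelInt_eq_of_map_eq _ (by rw [hA]; ext <;> simp [WeierstrassCurve.map])
  haveI : Fact (Nat.Prime 7) := ⟨by norm_num⟩
  have hc4 : W.c₄ = (1953 : ℚ) := by
    subst hW; norm_num [WeierstrassCurve.c₄, WeierstrassCurve.b₂, WeierstrassCurve.b₄]
  have hc6 : W.c₆ = (56079 : ℚ) := by
    subst hW; norm_num [WeierstrassCurve.c₆, WeierstrassCurve.b₂, WeierstrassCurve.b₄, WeierstrassCurve.b₆]
  have hu : (((Units.mk0 (((1 : ℚ) / 81896033746944)) (by norm_num))⁻¹ : ℚˣ) : ℚ) = (81896033746944 : ℚ) := by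
    rw [Units.val_inv_eq_inv_val, Units.val_mk0]; norm_num
  have hC : (⟨Units.mk0 (((1 : ℚ) / 81896033746944)) (by norm_num), (0 : ℚ), (0 : ℚ), ((-1 : ℚ) / 2)⟩ : VariableChange ℚ) • A =
      hessePencil5ind W.c₄ W.c₆ (-15 : ℚ) 1 := by
    rw [hc4, hc6, hessePencil5ind_eq_of_eval _ _ _ _ _ _ h4 h6, hA]
    ext
    · rw [variableChange_a₁, hu]; norm_num
    · rw [variableChange_a₂, hu]; norm_num
    · rw [variableChange_a₃, hu]; norm_num
    · rw [variableChange_a₄, hu]; norm_num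
    · rw [variableChange_a₆, hu]; norm_num
  exact bsdp_of_ainvs_of_bsdpPartner_of_hessePencil5ind_of_lvalue_of_analyticRank_le_one hF' hBCS hGr h5 hGV hS
    hPR hmodP hmodL hGZK 1 (-1) 1 (-41) (-55) hIW 0 0 1 32829 2026834 hIA
    7 3 8 3 (by decide +kernel) card_t155682d1_5 (by decide) (by decide) (by decide +kernel)
    card_t155682d1_7 (by decide) (by decide +kernel) card_h155682d1_f2_m15_1_5 (by decide)
    (hrE.le.trans (by decide)) hbsdA hSchA (by decide) hrA0 hLA
    (by rw [padicValRat.of_nat]; exact_mod_cast padicValNat.eq_zero_of_not_dvd (by norm_num)) (-15 : ℚ) 1 _ hC hC3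


end Summit.BirchSwinnertonDyer.Rank1Residual.X9

end
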